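import Summits.HubbardSuperconductivity.HubbardSuperconductivity.Theorems.AposterioriCapRgSsbToEvenTorusLroFacePurityOfGcRepelledChord
import Summits.HubbardSuperconductivity.HubbardSuperconductivity.Theorems.AposterioriCapRgSsbToEvenTorusLroGlueRepelledOrder
import Summits.HubbardSuperconductivity.HubbardSuperconductivity.Theorems.AposterioriCapRgSsbToEvenTorusLroSummitSectorSeed
import HarnessLib

/-!
# STRATEGY CENSUS — Lean companion (crux `SsbToEvenTorusLro`, stmt-HubbardSuperconductivity-1315)

Crux-strategist seat `planner-cstrat-stmt-HubbardSuperconductivity-1315-p1-0` (WALL-BREAKER, gen 1, 2026-08-17).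
Companion of `Cruxes/SsbToEvenTorusLro/STRATEGY-CENSUS.md`. Nothing here is a line for the crux (every concluding
skeleton must contain a `∀ (U, μ)`-guarded stability / selection stub, three times dead); this file records, kernel-checked:

§1 THE ROUTE-LEVEL DOOR, typed as candidate ITEMS for a tenure / route-repair edit of `AposterioriCapRg` (the
   strategist never edits `closes`): the target `FixedPointDWaveOrder` (… ∧ `HasDWaveOrder U μ`) is replaced by a box
   point carrying the grand-canonical REPELLED CHORD (`GcRepelledChordBoxPoint`) or Koma–Tasaki order of the
   block-REPELLED sourced family (`RepelledOrderBoxPoint`); the every-ground-state transfer `SsbToEvenTorusLro` and the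
   Koma–Tasaki order parameter both LEAVE the deciding theorem; the infrared half becomes an explicit item
   (`BoxInfraredLeak`, box-uniform pointwise Σ-leak) or item stmt-1089 `KacWindowPenalty.WindowInfraredBound` by name.
   Deciding terms (all sorry-free, over LANDED theorems of leads 0/c1 of line pair-yrast-landau-floor and the sibling
   disprover's dissection): `closes_grc_leak`, `closes_grc_1089`, `closes_rop_leak`, `closes_rop_1089`.
   WHY THIS IS A DOOR AND NOT A COSTUME: (O1) (dark iso-energetic partners) is discharged by the variational principle
   inside `facePurity_of_gcRepelledChordAt` (a dark ground state caps the repelled chord), and (O2) (order of limits) is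
   discharged inside `gcRepelledChord_of_repelledOrderAt` (energies are `8hL²`-Lipschitz in the source, so ONE positive
   source suffices) — neither needs `HasDWaveOrder`, the hypothesis that is finite-volume-inert (§3).
§2 DECOMPOSITION HAS NO STRICTLY EASIER LEAF (pointers): under the leak the crux IS derivative face purity
   (`deriv_iff_hasDWavePairFieldLROAt_of_leak`, sibling, landed); under summit-sector rigidity the crux IS the seed
   (`SsbToEvenTorusLro_iff_summitSectorSeed_o1`, landed p116197) — restated here as `example`s so the census's
   "which piece remains the whole crux" is by name.
§3 THE CRUX SHAPE IS MODEL-FREE FALSE (Negation lens, certificate `abstract_ssb_without_lro`): an abstract family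
   `(H_L, O_L)` on `ℂ²` whose Koma–Tasaki order parameter — literally the `liminf_{h→0⁺} liminf_L` shape of
   `dWaveOrderParameter` — equals `1`, while every source-free `H_L` has a UNIQUE, GAPPED ground state annihilated by
   `O_L`. So no argument from the order hypothesis + finite-dimensional spectral theory alone reaches any source-free
   finite-volume ground state; a proof must use Hubbard structure excluding iso-`μ` coexistence at EVERY ordered
   `(U, μ)` — which is what no technique supplies uniformly in `U` (Disproof gen 2 §8).
-/

noncomputable section

namespace Summit.HubbardSuperconductivity.HubbardSuperconductivity.Cruxes.SsbToEvenTorusLro.StrategyCensus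

set_option linter.dupNamespace false

open Literature.MathematicalPhysics.QuantumLattice Literature.Probability.LatticeModels
open Literature.Barriers.HubbardSuperconductivity (HasDWavePairFieldLROAt)
open Filter Set Matrix
open scoped ComplexOrder
open _root_.Topology
open Summit.HubbardSuperconductivity.HubbardSuperconductivity.Theses.AposterioriCapRg
  (SsbToEvenTorusLro FixedPointDWaveOrder)
open Summit.HubbardSuperconductivity.HubbardSuperconductivity.Theses.KacWindowPenalty (WindowInfraredBound)
open Summit.HubbardSuperconductivity.HubbardSuperconductivity.Theorems
open Summit.HubbardSuperconductivity.WcbcsSsbToTorusLRO.Negative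
  (floor_of_deriv_of_leak hasDWavePairFieldLROAt_of_floor leak_of_windowInfraredBound
    deriv_iff_hasDWavePairFieldLROAt_of_leak)

/-! ## §1 The route-level door, typed -/

/-- Grand-canonical density matching at `(U, δ, μ)` (the density clause of `FixedPointDWaveOrder`, verbatim). -/
def DensityMatched (U δ μ : ℝ) : Prop :=
  Filter.Tendsto (fun L : ℕ => ((hubbardTorusWith 2 (L + 1) 1 U μ).groundStateFunctional totalNumber).re / ((L + 1 : ℕ) : ℝ) ^ 2) Filter.atTop (nhds (1 - δ))

/-- **GRC at `(U, μ)`** — the grand-canonical REPELLED CHORD floor: one `a > 0`; for every block scale `R ≥ 1` a coupling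
`κ > 0` with `κ·a·L² ≤ E₀(K_μ + κW_R) − E₀(K_μ)` eventually along even sides (`W_R = R⁻⁴ Σ_a B_aᴴB_a`). Two source-free
grand-canonical ground ENERGIES; no state, no source, no sector, no order parameter. Verbatim the antecedent of the landed
`facePurity_of_gcRepelledChordAt`. [folklore] -/
def GcRepelledChordAt (U μ : ℝ) : Prop :=
  ∃ a : ℝ, 0 < a ∧ ∀ R : ℕ, 0 < R → ∃ κ : ℝ, 0 < κ ∧ ∀ᶠ k : ℕ in Filter.atTop, κ * a * ((2 * k + 1 + 1 : ℕ) : ℝ) ^ 2 ≤ (hubbardTorusWith 2 (2 * k + 1 + 1) 1 U μ + (κ : ℂ) • (((((R : ℝ) ^ 4)⁻¹ : ℝ) : ℂ) • ∑ a : Literature.Probability.LatticeModels.TorusSite 2 (2 * k + 1 + 1), (∑ u : Fin 2 → Fin R, localPair dWaveFormFactor (2 * k + 1 + 1) (a + fun i => ((u i : ℕ) : ZMod (2 * k + 1 + 1))))ᴴ * (∑ u : Fin 2 → Fin R, localPair dWaveFormFactor (2 * k + 1 + 1) (a + fun i => ((u i : ℕ) : ZMod (2 * k + 1 + 1)))))).groundEnergy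 - (hubbardTorusWith 2 (2 * k + 1 + 1) 1 U μ).groundEnergy

/-- **ROP at `(U, μ)`** — Koma–Tasaki `d`-wave order of the block-REPELLED SOURCED family `K_μ + κW_R − h(Δ_d+Δ_dᴴ)`, floor
`a` uniform in `R`, `L → ∞` at fixed small `h` (the route's own order of limits). Verbatim the antecedent of the landed
`gcRepelledChord_of_repelledOrderAt` (= body of the registered `stub_repelledOrderPersistence`). [folklore] -/
def RepelledOrderAt (U μ : ℝ) : Prop :=
  ∃ a : ℝ, 0 < a ∧ ∀ R : ℕ, 0 < R → ∃ κ : ℝ, 0 < κ ∧ ∃ h₀ : ℝ, 0 < h₀ ∧ ∀ h ∈ Set.Ioo (0:ℝ) h₀, ∀ᶠ L : ℕ in Filter.atTop, a ≤ ((dWaveSourceTorus (L + 1) U μ h + (κ : ℂ) • (((((R : ℝ) ^ 4)⁻¹ : ℝ) : ℂ) • ∑ a : Literature.Probability.LatticeModels.TorusSite 2 (L + 1), (∑ u : Fin 2 → Fin R, localPair dWaveFormFactor (L + 1) (a + fun i => ((u i : ℕ) : ZMod (L + 1))))ᴴ * (∑ u : Fin 2 → Fin R, localPair dWaveFormFactor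 (L + 1) (a + fun i => ((u i : ℕ) : ZMod (L + 1)))))).groundStateFunctional (pairField dWaveFormFactor (L + 1))).re / ((L + 1 : ℕ) : ℝ) ^ 2

/-- **Pointwise infrared LEAK at `(U, δ)`** (Σ-form, every sector ground state): verbatim the infrared hypothesis of the landed
`floor_of_deriv_of_leak`; item stmt-1089 supplies it for `δ < 1/2` (`leak_of_windowInfraredBound`). [folklore] -/
def InfraredLeakAt (U δ : ℝ) : Prop :=
  ∀ b : ℝ, 0 < b → ∃ η : ℝ, 0 < η ∧ ∀ᶠ k : ℕ in Filter.atTop, ∀ ψ : Fock (Orb (FermionTorus 2 (2 * k + 1 + 1))), IsGroundStateInSector (hubbardTorus 2 (2 * k + 1 + 1) 1 U) (2 * ⌊(1 - δ) * (((2 * k + 1 + 1) : ℕ) : ℝ) ^ 2 / 2⌋₊) 0 ψ → star ψ ⬝ᵥ ψ = 1 → (∑ m ∈ (Finset.univ.filter fun m : Literature.Probability.LatticeModels.TorusSite 2 (2 * k + 1 + 1) => m ≠ 0 ∧ momentumNormSq (2 * k + 1 + 1) m < η ^ 2), pairStructureFactor dWaveFormFactor (2 * k + 1 + 1) ψ m)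 / ((2 * k + 1 + 1 : ℕ) : ℝ) ^ 2 ≤ b

/-- Candidate TARGET (replaces `FixedPointDWaveOrder`): a point of the route's box with density matching and the GRC floor. -/
def GcRepelledChordBoxPoint : Prop :=
  ∃ U ∈ Set.Icc (2:ℝ) 3, ∃ δ ∈ Set.Icc (1/5:ℝ) (7/20), ∃ μ : ℝ, DensityMatched U δ μ ∧ GcRepelledChordAt U μ

/-- Candidate TARGET, ROP form (what a perturbation-slotted certified chain [2]→[3]→R naturally delivers). -/
def RepelledOrderBoxPoint : Prop :=
  ∃ U ∈ Set.Icc (2:ℝ) 3, ∃ δ ∈ Set.Icc (1/5:ℝ) (7/20), ∃ μ : ℝ, DensityMatched U δ μ ∧ RepelledOrderAt U μ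

/-- Candidate INFRARED item: the Σ-leak uniformly over the box (no strong-coupling exposure, unlike stmt-1089's `∀ U > 0`). -/
def BoxInfraredLeak : Prop :=
  ∀ U ∈ Set.Icc (2:ℝ) 3, ∀ δ ∈ Set.Icc (1/5:ℝ) (7/20), InfraredLeakAt U δ

theorem box_guards {U δ : ℝ} (hU : U ∈ Set.Icc (2:ℝ) 3) (hδ : δ ∈ Set.Icc (1/5:ℝ) (7/20)) :
    0 < U ∧ δ ∈ Set.Ioo (0:ℝ) 1 ∧ δ ∈ Set.Ioo (0:ℝ) (1 / 2) :=
  ⟨by linarith [hU.1], ⟨by linarith [hδ.1], by linarith [hδ.2]⟩, ⟨by linarith [hδ.1], by linarith [hδ.2]⟩⟩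

/-- ROP ⇒ GRC pointwise (landed `gcRepelledChord_of_repelledOrderAt`; the `h → 0` passage is inside). [folklore] -/
theorem gcRepelledChordAt_of_repelledOrderAt {U μ : ℝ} (h : RepelledOrderAt U μ) : GcRepelledChordAt U μ :=
  gcRepelledChord_of_repelledOrderAt h

theorem gcRepelledChordBoxPoint_of_repelledOrderBoxPoint (h : RepelledOrderBoxPoint) : GcRepelledChordBoxPoint := by
  obtain ⟨U, hU, δ, hδ, μ, hdm, hrop⟩ := h
  exact ⟨U, hU, δ, hδ, μ, hdm, gcRepelledChordAt_of_repelledOrderAt hrop⟩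

/-- **The summit matrix at `(U, δ)` from GRC at `(U, μ)`, density matching and the pointwise leak** — NO `HasDWaveOrder`,
NO `SsbToEvenTorusLro`: (O1) by the variational principle (`facePurity_of_gcRepelledChordAt`), the floor by the landed
Fejér closure (`floor_of_deriv_of_leak`), the matrix by the uniform-floor normal form. [folklore] -/
theorem matrix_of_gcRepelledChordAt_of_infraredLeakAt {U δ μ : ℝ} (hδ : δ ∈ Set.Ioo (0:ℝ) 1)
    (hdm : DensityMatched U δ μ) (hG : GcRepelledChordAt U μ) (hIR : InfraredLeakAt U δ) :
    HasDWavePairFieldLROAt U δ :=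
  hasDWavePairFieldLROAt_of_floor (floor_of_deriv_of_leak (facePurity_of_gcRepelledChordAt hδ hdm hG) hIR)

/-- **Deciding term, GRC target + box leak.** [folklore] -/
theorem closes_grc_leak (hT : GcRepelledChordBoxPoint) (hIR : BoxInfraredLeak) : _root_.HubbardSuperconductivity := by
  obtain ⟨U, hU, δ, hδ, μ, hdm, hG⟩ := hT
  obtain ⟨hU0, hδ1, hδ2⟩ := box_guards hU hδ
  unfold HubbardSuperconductivity Literature.Hubbard.DWaveSuperconductivityHubbard
  exact ⟨U, hU0, δ, hδ2, matrix_of_gcRepelledChordAt_of_infraredLeakAt hδ1 hdm hG (hIR U hU δ hδ)⟩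

/-- **Deciding term, GRC target + item stmt-1089 by name** (= landed
`hubbardSuperconductivity_of_boxPointWithGcRepelledChord_of_windowInfraredBound`). [folklore] -/
theorem closes_grc_1089 (hT : GcRepelledChordBoxPoint) (hW : WindowInfraredBound) : _root_.HubbardSuperconductivity :=
  hubbardSuperconductivity_of_boxPointWithGcRepelledChord_of_windowInfraredBound hT hW

/-- **Deciding term, ROP target + box leak.** [folklore] -/
theorem closes_rop_leak (hT : RepelledOrderBoxPoint) (hIR : BoxInfraredLeak) : _root_.HubbardSuperconductivity :=
  closes_grc_leak (gcRepelledChordBoxPoint_of_repelledOrderBoxPoint hT) hIR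

/-- **Deciding term, ROP target + item stmt-1089.** [folklore] -/
theorem closes_rop_1089 (hT : RepelledOrderBoxPoint) (hW : WindowInfraredBound) : _root_.HubbardSuperconductivity :=
  closes_grc_1089 (gcRepelledChordBoxPoint_of_repelledOrderBoxPoint hT) hW

/-- Sanity: the CURRENT target's `(U, δ, μ)`-data are exactly what the new targets ask besides the chord/order floor —
`FixedPointDWaveOrder` minus `HasDWaveOrder` plus GRC is `GcRepelledChordBoxPoint`. [folklore] -/
theorem gcRepelledChordBoxPoint_of_fixedPoint_of_grc (hT : FixedPointDWaveOrder)
    (hall : ∀ U μ : ℝ, HasDWaveOrder U μ → GcRepelledChordAt U μ) : GcRepelledChordBoxPoint := by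
  obtain ⟨U, hU, δ, hδ, μ, hdm, hord⟩ := hT
  exact ⟨U, hU, δ, hδ, μ, hdm, hall U μ hord⟩

/-! ## §2 Decomposition: no strictly easier leaf (by name) -/

/-- Under the pointwise leak, derivative face purity at `(U, δ)` IS the summit matrix at `(U, δ)` (sibling, landed). -/
example {U δ : ℝ} (hδ : 0 ≤ δ) (hIR : InfraredLeakAt U δ) :
    (∃ a : ℝ, 0 < a ∧ ∀ R : ℕ, 0 < R → ∀ᶠ k : ℕ in Filter.atTop, ∀ ψ : Fock (Orb (FermionTorus 2 (2 * k + 1 + 1))), IsGroundStateInSector (hubbardTorus 2 (2 * k + 1 + 1) 1 U) (2 * ⌊(1 - δ) * ((2 * k + 1 + 1 : ℕ) : ℝ) ^ 2 / 2⌋₊) 0 ψ → star ψ ⬝ᵥ ψ = 1 → a * ((2 * k + 1 + 1 : ℕ) : ℝ) ^ 2 ≤ (star ψ ⬝ᵥ ((((((R : ℝ) ^ 4)⁻¹ : ℝ) : ℂ) • ∑ x : TorusSite 2 (2 * k + 1 + 1), (∑ u : Fin 2 → Fin R, localPair dWaveFormFactor (2 * k + 1 + 1) (x + fun i => ((u i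 : ℕ) : ZMod (2 * k + 1 + 1))))ᴴ * (∑ u : Fin 2 → Fin R, localPair dWaveFormFactor (2 * k + 1 + 1) (x + fun i => ((u i : ℕ) : ZMod (2 * k + 1 + 1))))) *ᵥ ψ)).re) ↔ HasDWavePairFieldLROAt U δ :=
  deriv_iff_hasDWavePairFieldLROAt_of_leak hδ hIR

/-- Under summit-sector rigidity (any vanishing relative tolerance), the crux IS the seed (landed p116197). -/
example := @SsbToEvenTorusLro_iff_summitSectorSeed_o1


/-! ## §3 Negation lens: the crux SHAPE is model-free false (abstract two-level certificate)

The crux's order hypothesis is a Koma–Tasaki order parameter: source `-h(O + Oᴴ)`, tracial ground-state functional,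
`L → ∞` FIRST (inner `liminf`), then `h ↓ 0` (outer `liminf` over `𝓝[>] 0`) — `ktOrderParameter` below is literally
the shape of `dWaveOrderParameter` with `(hubbardTorusWith, Δ_d)` replaced by an abstract family `(H_L, O_L)`. The
two-level family `H_L = diag(1, 0)`, `O_L = L²·diag(1, 0)` has order parameter `1` (for every `h > 0` the source wins
as soon as `2hL² > 1`), while every source-free `H_L` has the UNIQUE ground ray `e₁`, annihilated by `O_L`: full
"SSB" in the Koma–Tasaki sense, ZERO order (and zero fluctuation) in every finite-volume ground state. Hence the
implication "KT order ⇒ LRO of (some / every) source-free finite-volume ground state" is not a theorem of spectral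
theory plus the order of limits; the selection happens at the level crossing `h_c(L) = 1/(2L²) → 0`, below the
resolution of any `h`-fixed-then-`L → ∞` hypothesis. (This is the (O2) half of the wall; the (O1) half — iso-energetic
dark partners — is `Cruxes.BirEveryGroundState.Disproof.not_abstractDarkPartnerExclusion`, landed.) -/

section Toy

/-- Koma–Tasaki order parameter of an abstract family `(H_L, O_L)`: the literal shape of `dWaveOrderParameter`
(`Re ω₀[H_{L+1} − h(O_{L+1} + O_{L+1}ᴴ)](O_{L+1}) / (L+1)²`, `liminf_L` inside, `liminf_{h → 0⁺}` outside). -/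
def ktOrderParameter {n : Type*} [Fintype n] [DecidableEq n] (H O : ℕ → Matrix n n ℂ) : ℝ :=
  liminf (fun h : ℝ => liminf (fun L : ℕ =>
    ((H (L + 1) - (h : ℂ) • (O (L + 1) + (O (L + 1))ᴴ)).groundStateFunctional (O (L + 1))).re /
      ((L + 1 : ℕ) : ℝ) ^ 2) atTop) (𝓝[>] 0)

/-- The two-level matrices `diag(c, 0)`. -/
def toyMat (c : ℝ) : Matrix (Fin 2) (Fin 2) ℂ :=
  Matrix.diagonal ![(c : ℂ), 0]

theorem toyMat_apply_diag (c : ℝ) : (fun i => toyMat c i i) = ![(c : ℂ), 0] := by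
  funext i; simp [toyMat]

theorem toyMat_isHermitian (c : ℝ) : (toyMat c).IsHermitian := by
  unfold toyMat
  rw [Matrix.IsHermitian, Matrix.diagonal_conjTranspose]
  congr 1
  funext i
  fin_cases i <;> simp

theorem toyMat_conjTranspose (c : ℝ) : (toyMat c)ᴴ = toyMat c :=
  toyMat_isHermitian c

theorem toyMat_add (c d : ℝ) : toyMat c + toyMat d = toyMat (c + d) := by
  unfold toyMat
  rw [Matrix.diagonal_add]
  congr 1
  funext i
  fin_cases i <;> simp

theorem toyMat_smul (r c : ℝ) : (r : ℂ) • toyMat c = toyMat (r * c) := by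
  unfold toyMat
  rw [← Matrix.diagonal_smul]
  congr 1
  funext i
  fin_cases i <;> simp

theorem toyMat_sub_smul (c r d : ℝ) : toyMat c - (r : ℂ) • (toyMat d + (toyMat d)ᴴ) = toyMat (c - 2 * r * d) := by
  rw [toyMat_conjTranspose, toyMat_add, toyMat_smul, sub_eq_iff_eq_add, toyMat_add]
  congr 1
  ring

/-- `diag(c,0) ψ` componentwise. -/
theorem toyMat_mulVec (c : ℝ) (ψ : Fin 2 → ℂ) : toyMat c *ᵥ ψ = ![(c : ℂ) * ψ 0, 0] := by
  unfold toyMat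
  funext i
  rw [Matrix.mulVec_diagonal]
  fin_cases i <;> simp

/-- The Rayleigh numerator of `diag(c, 0)`: `⟨ψ, diag(c,0) ψ⟩ = c |ψ₀|²`. -/
theorem toy_rayleigh (c : ℝ) (ψ : Fin 2 → ℂ) :
    star ψ ⬝ᵥ toyMat c *ᵥ ψ = ((c * Complex.normSq (ψ 0) : ℝ) : ℂ) := by
  rw [toyMat_mulVec, dotProduct, Fin.sum_univ_two]
  simp only [Pi.star_apply, Matrix.cons_val_zero, Matrix.cons_val_one, mul_zero, add_zero,
    Complex.star_def]
  rw [Complex.ofReal_mul, Complex.normSq_eq_conj_mul_self]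
  ring

/-- `⟨ψ, ψ⟩ = |ψ₀|² + |ψ₁|²`. -/
theorem toy_normSq (ψ : Fin 2 → ℂ) :
    star ψ ⬝ᵥ ψ = ((Complex.normSq (ψ 0) + Complex.normSq (ψ 1) : ℝ) : ℂ) := by
  rw [dotProduct, Fin.sum_univ_two]
  simp only [Pi.star_apply, Complex.star_def]
  rw [Complex.ofReal_add, Complex.normSq_eq_conj_mul_self, Complex.normSq_eq_conj_mul_self]

/-- Ground energy from a lower bound attained at a unit vector (variational principle both ways). [folklore] -/
theorem groundEnergy_eq_of_bound {n : Type*} [Fintype n] [DecidableEq n] [Nonempty n] {A : Matrix n n ℂ}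
    (hA : A.IsHermitian) (c : ℝ) (hlow : ∀ ψ : n → ℂ, star ψ ⬝ᵥ ψ = 1 → c ≤ (star ψ ⬝ᵥ A *ᵥ ψ).re)
    (ψ₀ : n → ℂ) (hψ₀ : star ψ₀ ⬝ᵥ ψ₀ = 1) (hat : (star ψ₀ ⬝ᵥ A *ᵥ ψ₀).re = c) : A.groundEnergy = c := by
  apply le_antisymm
  · rw [← hat]; exact groundEnergy_le_rayleigh_holds hA ψ₀ hψ₀
  · rw [← minEnergyOn_top_holds hA]
    refine le_csInf ⟨c, ψ₀, Submodule.mem_top, hψ₀, hat.symm⟩ ?_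
    rintro E ⟨φ, -, hφ1, rfl⟩
    exact hlow φ hφ1

theorem unit_components {ψ : Fin 2 → ℂ} (hψ : star ψ ⬝ᵥ ψ = 1) :
    Complex.normSq (ψ 0) + Complex.normSq (ψ 1) = 1 := by
  rw [toy_normSq] at hψ
  exact_mod_cast hψ

/-- `E₀(diag(c,0)) = c` for `c ≤ 0` (attained at `e₀`). -/
theorem groundEnergy_toyMat_of_nonpos {c : ℝ} (hc : c ≤ 0) : (toyMat c).groundEnergy = c := by
  refine groundEnergy_eq_of_bound (toyMat_isHermitian c) c ?_ (Pi.single 0 1) ?_ ?_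
  · intro ψ hψ
    have h1 := unit_components hψ
    rw [toy_rayleigh, Complex.ofReal_re]
    nlinarith [Complex.normSq_nonneg (ψ 0), Complex.normSq_nonneg (ψ 1)]
  · rw [toy_normSq]; simp
  · rw [toy_rayleigh, Complex.ofReal_re]; simp

/-- `E₀(diag(c,0)) = 0` for `0 ≤ c` (attained at `e₁`). -/
theorem groundEnergy_toyMat_of_nonneg {c : ℝ} (hc : 0 ≤ c) : (toyMat c).groundEnergy = 0 := by
  refine groundEnergy_eq_of_bound (toyMat_isHermitian c) 0 ?_ (Pi.single 1 1) ?_ ?_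
  · intro ψ hψ
    rw [toy_rayleigh, Complex.ofReal_re]
    exact mul_nonneg hc (Complex.normSq_nonneg _)
  · rw [toy_normSq]; simp
  · rw [toy_rayleigh, Complex.ofReal_re]; simp

/-- In the field-dominated regime `c < 0` the tracial ground state of `diag(c,0)` gives `diag(d,0)` the value `d`
(`ω(A) = E₀(A) = c` and linearity). -/
theorem groundStateFunctional_toyMat_of_neg {c : ℝ} (hc : c < 0) (d : ℝ) :
    ((toyMat c).groundStateFunctional (toyMat d)).re = d := by
  have hH := groundStateFunctional_hamiltonian (toyMat_isHermitian c)
  rw [groundEnergy_toyMat_of_nonpos hc.le] at hH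
  have hd : toyMat d = ((d / c : ℝ) : ℂ) • toyMat c := by
    rw [toyMat_smul, div_mul_cancel₀ d hc.ne]
  rw [hd, map_smul, hH, smul_eq_mul, ← Complex.ofReal_mul, Complex.ofReal_re, div_mul_cancel₀ d hc.ne]

/-- The toy Hamiltonians `H_L = diag(1, 0)` (independent of `L`). -/
def toyH : ℕ → Matrix (Fin 2) (Fin 2) ℂ := fun _ => toyMat 1

/-- The toy order operators `O_L = L² · diag(1, 0)` (extensive normalisation, like `Δ_d`). -/
def toyO : ℕ → Matrix (Fin 2) (Fin 2) ℂ := fun L => toyMat ((L : ℝ) ^ 2)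

/-- For every fixed source `h > 0` the finite-volume order density is EXACTLY `1` as soon as `2h(L+1)² > 1`. -/
theorem toy_density_eventually {h : ℝ} (hh : 0 < h) :
    ∀ᶠ L : ℕ in atTop, ((toyH (L + 1) - (h : ℂ) • (toyO (L + 1) + (toyO (L + 1))ᴴ)).groundStateFunctional
      (toyO (L + 1))).re / ((L + 1 : ℕ) : ℝ) ^ 2 = 1 := by
  filter_upwards [eventually_gt_atTop (⌈1 / (2 * h)⌉₊)] with L hL
  have hL' : 1 / (2 * h) < (L : ℝ) := lt_of_le_of_lt (Nat.le_ceil _) (by exact_mod_cast hL)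
  have hpos : (0 : ℝ) < ((L + 1 : ℕ) : ℝ) := by positivity
  have hbig : 1 < 2 * h * (((L + 1 : ℕ) : ℝ) ^ 2) := by
    have h2 : 1 < 2 * h * (L : ℝ) := by
      rw [div_lt_iff₀ (by positivity)] at hL'; linarith
    have h3 : (L : ℝ) ≤ ((L + 1 : ℕ) : ℝ) ^ 2 := by
      have e : ((L + 1 : ℕ) : ℝ) = (L : ℝ) + 1 := by push_cast; ring
      rw [e]
      nlinarith [sq_nonneg (L : ℝ), (Nat.cast_nonneg L : (0 : ℝ) ≤ L)]
    nlinarith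
  simp only [toyH, toyO]
  rw [toyMat_sub_smul, groundStateFunctional_toyMat_of_neg (by linarith [hbig]), div_self (by positivity)]

/-- **The toy has full Koma–Tasaki order: order parameter `= 1`.** -/
theorem ktOrderParameter_toy : ktOrderParameter toyH toyO = 1 := by
  unfold ktOrderParameter
  have hinner : ∀ h : ℝ, 0 < h → liminf (fun L : ℕ =>
      ((toyH (L + 1) - (h : ℂ) • (toyO (L + 1) + (toyO (L + 1))ᴴ)).groundStateFunctional (toyO (L + 1))).re /
        ((L + 1 : ℕ) : ℝ) ^ 2) atTop = 1 := by
    intro h hh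
    rw [liminf_congr (toy_density_eventually hh), liminf_const]
  set F : ℝ → ℝ := fun h : ℝ => liminf (fun L : ℕ =>
      ((toyH (L + 1) - (h : ℂ) • (toyO (L + 1) + (toyO (L + 1))ᴴ)).groundStateFunctional (toyO (L + 1))).re /
        ((L + 1 : ℕ) : ℝ) ^ 2) atTop with hF
  have hev : ∀ᶠ h in 𝓝[>] (0 : ℝ), F h = (fun _ : ℝ => (1 : ℝ)) h :=
    eventually_nhdsWithin_of_forall (s := Set.Ioi (0 : ℝ)) fun h (hh : 0 < h) => by
      simp only [hF]; exact hinner h hh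
  rw [liminf_congr hev, liminf_const]

/-- **… yet every source-free ground state is DARK and the ground state is UNIQUE (ray `e₁`).** -/
theorem toy_groundStates (L : ℕ) (ψ : Fin 2 → ℂ) (hψ : (toyH L).IsGroundStateVector ψ) :
    toyO L *ᵥ ψ = 0 ∧ ψ = ψ 1 • Pi.single 1 1 := by
  obtain ⟨-, hev⟩ := hψ
  have hE : (toyH L).groundEnergy = 0 := groundEnergy_toyMat_of_nonneg zero_le_one
  rw [hE, Complex.ofReal_zero, zero_smul] at hev
  have h0 : ψ 0 = 0 := by
    have := congrFun hev 0
    simp only [toyH, toyMat_mulVec, Matrix.cons_val_zero, Pi.zero_apply, Complex.ofReal_one, one_mul] at this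
    exact this
  constructor
  · simp only [toyO, toyMat_mulVec, h0, mul_zero]
    funext i; fin_cases i <;> simp
  · funext i
    fin_cases i
    · simp [h0]
    · simp

/-- **CERTIFICATE (Negation lens): the crux's shape is model-free false.** There is an abstract family with
Koma–Tasaki order parameter `1` (order of limits exactly as in `dWaveOrderParameter`) all of whose source-free
finite-volume ground states are order-dark, with a unique ground ray at every volume. [folklore] -/
theorem abstract_ssb_without_lro :
    ∃ (H O : ℕ → Matrix (Fin 2) (Fin 2) ℂ),
      (∀ L, (H L).IsHermitian) ∧ (∀ L, (O L).IsHermitian) ∧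
      ktOrderParameter H O = 1 ∧
      (∀ L, (H L).groundEnergy = 0) ∧
      (∀ (L : ℕ) (ψ : Fin 2 → ℂ), (H L).IsGroundStateVector ψ → O L *ᵥ ψ = 0 ∧ ψ = ψ 1 • Pi.single 1 1) :=
  ⟨toyH, toyO, fun _ => toyMat_isHermitian 1, fun _ => toyMat_isHermitian _, ktOrderParameter_toy,
    fun _ => groundEnergy_toyMat_of_nonneg zero_le_one, toy_groundStates⟩

end Toy

end Summit.HubbardSuperconductivity.HubbardSuperconductivity.Cruxes.SsbToEvenTorusLro.StrategyCensus

end
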